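import Summits.QuantumFields.YangMills.Theorems.UnitScaleTiltProp7OneFormAgmonAveraging
import Summits.QuantumFields.YangMills.Theorems.UnitScaleTiltProp7OneFormAgmonLocal
import HarnessLib

/-!
# Route `UnitScaleTilt`, crux K1 «MinimiserStabilityRegPr» (stmt-QuantumFields-19200), EX face S45 — (L3′b)-VALUE, ONE-FORM STOREY, pen (P-1FA) «ONE-FORM AGMON», FILE A2c:
# ★★★ **THE `hVconj` LETTER OF A3 ✓∕⧗`Prop7OneFormAgmon.agmon_oneForm_of_letters` FROM THE MEMBER LETTERS** — the conjugation defect `θ_V` of `V := Δ_a − D†D` under a positive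
# weight, as the sum of the four pieces (Q) averaging penalty (A2b), (P) the `L²`-bounded `D(1−R_S)D*` against its displayed `h349`-kernel (A2a §4), (S) the slot, (L) the local pair (A2d)

Cell `ym3-torus` (HUMAN RULING D-0037; rung R3 = SU(2) YM₃ on T³ — NOT d = 4, NOT infinite volume, NOT a mass gap, NOT Clay).  Width seat `ym3-torus-px21` (gen 14);
★p1 g26 CHAIR WORD №6 SPLIT: A1 ✓`Prop7OneFormGarding` (chair), A2 = px21 (THIS series), A3 ✓∕⧗`Prop7OneFormAgmon` (chair; its hypothesis `hVconj` is the export of this series).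
THEOREMS ONLY (0 `def`, 0 `sorry`); `--supports stmt-QuantumFields-19200 --as helper`; count-neutral.

WHY ∕ HOW.  A2a ✓`inner_laplaceA_eq₂` at `(w(b₋)·X, w(b₋)⁻¹·X)` minus the diagonal: the Kato pairings are exactly the ones `hVconj` subtracts on both sides, and the four remaining pieces are
bounded by A2b ✓`abs_re_inner_Qk_conj_sub_le` (+ an operator bound `‖Q_kv‖ ≤ C_Q‖v‖`, px17 ✓`norm_Qk_le_of_regPr`), A2a ✓`abs_re_inner_conj_kernel_sub_le` at `B := D∘(1 − R_S)∘D*` (kernel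
row `hk` = the EX row `h349`'s member text), the slot's own letter `hslot` (`θ_S = 0` at the slot of record `DeltaEtaSlot`, §8) and A2d ✓`Prop7OneFormAgmonLocal.hlocw_of_regPr` (the `L²` edition of O1's
local letter, conjugated — PROVED from the range-1 locality of lit `deltaPrimeOp`∕`curvOp`).
WHAT IS PROVED (ns `Summit.QuantumFields.YangMills.Theorems.Prop7OneFormAgmonConj`).
* §7 ★★★ `hVconj_of_letters` — `RegPr F n K ε₀ U₀` + routeR-w4's windows, `0 ≤ a`, a positive site weight with A3's bond ratios `hρ`∕`hρ′`, the (Q) read-set ratios `ρ_Q` and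
  the (P) far ratios `|w x∕w x′ − 1| ≤ θc·e^{ν·tdist(Bx,Bx′)}` (`ν < μ′`), the letters `hk` (`Ck`, `μ′`), `hQ` (`C_Q`), `hslot` (`θ_S`) ⟹ FOR EVERY bond field `X`:
  `re⟪toL2 X, Δ_a(toL2 X)⟫ − Σ_μ‖D_{U₀}(toL2S X_μ)‖² − θ_V‖toL2 X‖² ≤ re⟪toL2(w(b₋)·X), Δ_a(toL2(w(b₋)⁻¹·X))⟫ − re Σ_μ⟪D_{U₀}(toL2S (w(b₋)·X)_μ), D_{U₀}(toL2S (w(b₋)⁻¹·X)_μ)⟫`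
  with `θ_V = a·(2√κ²·C_Q + κ²) + √2·Ck·θc·(d·(L^d)^{K−n}·(2(1+1∕(μ′−ν)))³) + θ_S + 32√2·ε₀·d·6^d·(1 + (1+ρ)²)`, `κ² = 216ρ_Q²(cB∕(c₀ℓ³))` — EXACTLY A3's `hVconj` (spellings `fun b => w b.src • X b` ∕
  `fun b => (w b.src)⁻¹ • X b`, `re` outside the Kato sum).  At the pins (`a = a₀(c₀∕cB)ℓ³`, `cB = c₀ℓ³`, `Ck = C₃₄₉ℓ⁻³`, `C_Q = 6√(cB∕c₀)√(ℓ⁻³)`) every constant is K-FREE and `θ_V → 0` with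
  the weight's slope (`ρ_Q, θc → 0`), as the Combes–Thomas∕Agmon argument wants.
* §8 `hslot_DeltaEtaSlot` (the slot letter at the slot of record holds with `θ_S = 0`), ★★ `hVconj_of_letters_DeltaEtaSlot` (§7 at `Δx := DeltaEtaSlot`, no slot letter).
HYP-SAT (★★OWNER RULING №42): as A2a∕A2b∕A2d; `hQ` ⟸ px17 ✓`Prop7QkAdjointSupRowOfRegPr.norm_Qk_le_of_regPr`; `hk` ⟸ V6 + (ii-c) under Lift (the EX row `h349`'s own text); `hslot` the slot's
letter (killed at `DeltaEtaSlot`); nothing eventual; non-vacuous (flat member: all letters explicit).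
HONEST SCOPE.  Bookkeeping over A2a∕A2b; CONDITIONAL on the displayed letters; nothing of the ten EX rows, `hT`, (3.46)∕Thm 3.12 for print's operators, EX `stub_existenceMinimalOrbit` or the
crux is proved here; the Yang–Mills mass gap is NOT proved.

References: T. Bałaban, CMP **99** (1985) 389–434 [Balaban1985BackgroundPropagators] ((3.3) p.391, (3.11) p.392, (3.13)–(3.16) p.393, (3.21)–(3.26) pp.394–395, Thm 3.1 (3.46) p.398,
(3.49) p.399, Thm 3.12 p.422); CMP **102** (1985) 277–309 [Balaban1985Variational] ((44)–(45) p.285, (134)–(136) p.298); CMP **95** (1984) 17–40 [Balaban1984PropagatorsI] ((1.18) p.20);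
S. Agmon, *Lectures on exponential decay of solutions of second-order elliptic equations* (Princeton 1982) Ch. 1 [Agmon1982].
-/

set_option autoImplicit false

noncomputable section

open scoped BigOperators Matrix.Norms.L2Operator InnerProductSpace ComplexConjugate

namespace Summit.QuantumFields.YangMills.Theorems.Prop7OneFormAgmonConj

open Literature.MathematicalPhysics.QuantumFieldTheory.Balaban1983to89
open Literature.MathematicalPhysics.QuantumFieldTheory.Balaban1983to89.T3ContinuumYM3Torus
open T3SectALandauChart (eta eta_pos bgUnits formComp)
open B9TorusCalculus (torusT)
open B9Eq310Hermitian (deltaPrimeOp)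
open B11Eq135Weitzenbock (curvOp)
open B11Eq103H1Complex (SiteL2K BondL2K)
open B9Eq39Adjoint (R)
open B5Eq118OneStroke (iterBlockOf)
open Summit.QuantumFields.YangMills.Theorems.Prop7SectET3Transport (periodsT3 siteEquiv bondEquiv)
open Summit.QuantumFields.YangMills.Theorems.Prop7SectET3HilbertLetters (W₂ frobEquiv toL2 toL2S DL2 DstarL2 covLapSite adjoint_DL2 inner_toL2 inner_covLapSite)
open Summit.QuantumFields.YangMills.Theorems.Prop7SectET3WilsonHessian (DeltaEta DeltaEtaSlot)
open Summit.QuantumFields.YangMills.Theorems.Prop7SectET3GaugeProjector (RS RS_eq_projR)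
open Summit.QuantumFields.YangMills.Theorems.Prop7SectET3CurvedPropagators (laplaceA Qk)
open Summit.QuantumFields.YangMills.Theorems.Prop7SectET3DeltaEtaExplicit (sum_pbond_eq)
open Summit.QuantumFields.YangMills.Theorems.Prop7RieszTauFrobNorm (norm_sq_frobEquiv_symm norm_le_norm_frobEquiv_symm norm_frobEquiv_symm_le)
open Summit.QuantumFields.YangMills.Theorems.Prop7LaplaceAFlatLetters (norm_sq_toL2 norm_sq_toL2S)
open Summit.QuantumFields.YangMills.Theorems.Prop7BlockBumpExtension (sum_comp_iterBlockOf)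
open Summit.QuantumFields.YangMills.Theorems.Prop7BlockDistanceWeights (sum_exp_neg_mul_tdist_coarse_le tdist_coarse_comm eta_mul_pow_eq_one)
open Summit.QuantumFields.YangMills.Theorems.Prop7MassivePropagatorAgmonLetters (inner_toL2S_smul_left inner_toL2_smul_left inner_toL2S_smul_smul_inv
  inner_toL2_smul_smul_inv DL2_smul_eq_smul_add_defect normSq_gradDefect_le)
open Summit.QuantumFields.YangMills.Theorems.Prop7OneFormKatoForm (covLapSite_toL2S_formComp_eq)
open Summit.QuantumFields.YangMills.Theorems.Prop7OneFormGarding (sum_inner_toL2S_formComp)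
open T3PrintedRegularMinimiser (RegPr)
open T3PrintedRegularOrbits (sites_eq)
open T3LevelShift (bondShift)
open Summit.QuantumFields.YangMills.Theorems.Prop7SymAvgTwSym (QTwS)
open Summit.QuantumFields.YangMills.Theorems.Prop7SectET3HilbertLetters (toL2B inner_toL2B)
open Summit.QuantumFields.YangMills.Theorems.Prop7TransverseRowOfTubeRowRegPr (Qk_toL2)
open Summit.QuantumFields.YangMills.Theorems.Prop7EngOfTrueAvgBudget (norm_toL2B_sq)
open Summit.QuantumFields.YangMills.Theorems.Prop7CmapTwSReadSet (QTwS_congr_of_agree)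
open Summit.QuantumFields.YangMills.Theorems.Prop7QTwSEllTwoBound (sum_normSq_entries_QTwS_le)
open Summit.QuantumFields.YangMills.Theorems.Prop7QkCutoffCommutator (sum_sum_read_le)
open Summit.QuantumFields.YangMills.Theorems.Prop7OneFormAgmonLetters (inner_laplaceA_eq₂ abs_re_inner_conj_kernel_sub_le)
open Summit.QuantumFields.YangMills.Theorems.Prop7OneFormAgmonAveraging (abs_re_inner_Qk_conj_sub_le)
open Summit.QuantumFields.YangMills.Theorems.Prop7OneFormAgmonLocal (hlocw_of_regPr)

/-! ## §7 ★★★ The export: the `hVconj` letter of A3 ✓`Prop7OneFormAgmon.agmon_oneForm_of_letters` from the member letters -/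

section Export

variable (F : T3Family) {n K : ℕ} (h : n ≤ K) (c₀ cB : ℝ) [Fact (0 < c₀)] [Fact (0 < cB)] {a : ℝ}
  {Δx : GaugeField (F.P K) 0 (Matrix.specialUnitaryGroup (Fin 2) ℂ) → (BondL2K ℂ 3 (periodsT3 F K) c₀ W₂ →ₗ[ℂ] BondL2K ℂ 3 (periodsT3 F K) c₀ W₂)}

set_option maxHeartbeats 400000 in
-- hb: two mixed form identities of `Δ_a` + four letter bounds knit by `linarith` over long carrier expressions.
/-- ★★★ **THE `hVconj` LETTER OF THE ONE-FORM AGMON BOUND, FROM THE MEMBER LETTERS.**  `RegPr F n K ε₀ U₀` with routeR-w4's windows `10¹⁰L⁶ε₀ ≤ 1`, `10¹²L³ε₀ ≤ 1`; a positive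
site weight `w` with (Q) read-set relative oscillations `≤ ρ_Q` against reference sites `x_r(ĉ)` and (P) far ratios `|w x∕w x′ − 1| ≤ θc·e^{ν·tdist(Bx,Bx′)}`; the DISPLAYED letters:
(P) the pointwise kernel row of `D_{U₀}(1 − R_S)D*_{U₀}` in the EX row `h349`'s member text with a free constant `Ck` and rate `μ′ > ν` (⟸ V6 ✓`norm_equiv_DL2_sub_projR_DstarL2_single_le` +
✓p764569 (ii-c) under Lift, `Ck = C₃₄₉·ℓ⁻³`), (Q′) an operator bound `‖Q_k v‖ ≤ C_Q‖v‖` (px17 ✓`norm_Qk_le_of_regPr`: `C_Q = 6√(cB∕c₀)√(ℓ⁻³)`), (S) the slot's own conjugation letter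
`θ_S` (`= 0` at `DeltaEtaSlot`, §8); the (L) local pair is DISCHARGED (A2d ✓`Prop7OneFormAgmonLocal.hlocw_of_regPr`, `C_locw = 32√2·ε₀·d·6^d·(1 + (1+ρ)²)`).  THEN for every bond
field `X`, with `θ_V := a·(2√κ²·C_Q + κ²) + √2·Ck·θc·(d·(L^d)^{K−n}·(2(1+1∕(μ′−ν)))³) + θ_S + 32√2·ε₀·d·6^d·(1 + (1+ρ)²)`, `κ² = 216ρ_Q²(cB∕(c₀ℓ³))`:
`re⟪toL2 X, Δ_a(toL2 X)⟫ − Σ_μ‖D_{U₀}(toL2S X_μ)‖² − θ_V‖toL2 X‖² ≤ re⟪toL2(w(b₋)·X), Δ_a(toL2(w(b₋)⁻¹·X))⟫ − re Σ_μ ⟪D_{U₀}(toL2S (w(b₋)·X)_μ), D_{U₀}(toL2S (w(b₋)⁻¹·X)_μ)⟫`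
— EXACTLY the hypothesis `hVconj` of A3, so that `agmon_oneForm_of_letters` yields `Θ·‖w·Gf‖ ≤ ‖w·f‖` with `Θ = (1−ε)γ − εC_V − 3η⁻²ρ²(1+1∕ε) − θ_V`, every constant K-free at the pins.
[cite: Balaban1985BackgroundPropagators, (3.26) p.395, Thm 3.1 (3.46) p.398, (3.49) p.399, Thm 3.12 p.422; Balaban1985Variational, (134)–(136) p.298; Agmon1982, Ch. 1] -/
theorem hVconj_of_letters {ε₀ : ℝ} (hε₀ : 0 < ε₀) (hε : 10 ^ 10 * (F.L : ℝ) ^ 6 * ε₀ ≤ 1) (hε12 : 10 ^ 12 * (F.L : ℝ) ^ 3 * ε₀ ≤ 1)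
    (U₀ : GaugeField (F.P K) 0 (Matrix.specialUnitaryGroup (Fin 2) ℂ)) (hreg : RegPr F n K ε₀ U₀) (ha : 0 ≤ a)
    (w : Site (F.P K) 0 → ℝ) (hw : ∀ x, 0 < w x) {ρ : ℝ}
    (hρ : ∀ b : PBond (F.P K) 0, |w b.tgt / w b.src - 1| ≤ ρ) (hρ' : ∀ b : PBond (F.P K) 0, |w b.src / w b.tgt - 1| ≤ ρ)
    (xr : PBond (F.P n) 0 → Site (F.P K) 0) {ρQ : ℝ}
    (hρQ : ∀ (c : PBond (F.P n) 0) (b : PBond (F.P K) 0),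
      (iterBlockOf (K - n) b.src = (bondShift (sites_eq F n K h) c).src ∨ iterBlockOf (K - n) b.src = (bondShift (sites_eq F n K h) c).tgt) →
      |w b.src / w (xr c) - 1| ≤ ρQ ∧ |w (xr c) / w b.src - 1| ≤ ρQ)
    {θc ν μ' Ck : ℝ} (hθc : 0 ≤ θc) (hCk : 0 ≤ Ck) (hνμ : ν < μ')
    (hwfar : ∀ x x' : Site (F.P K) 0, |w x / w x' - 1| ≤ θc * Real.exp (ν * (Site.tdist (P := F.P K) (iterBlockOf (K - n) x) (iterBlockOf (K - n) x') : ℝ)))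
    (hk : ∀ (b : PBond (F.P K) 0) (Z : Matrix (Fin 2) (Fin 2) ℂ) (bd : PBond (F.P K) 0),
      ‖(toL2 F K c₀).symm (DL2 F n K c₀ U₀ (DstarL2 F n K c₀ U₀ (toL2 F K c₀ (Pi.single b Z)) - RS F n K h c₀ cB U₀ (DstarL2 F n K c₀ U₀ (toL2 F K c₀ (Pi.single b Z))))) bd‖
        ≤ Ck * Real.exp (-(μ' * (Site.tdist (P := F.P K) (iterBlockOf (K - n) b.src) (iterBlockOf (K - n) bd.src) : ℝ))) * ‖Z‖)
    {CQ : ℝ} (hQ : ∀ v : BondL2K ℂ 3 (periodsT3 F K) c₀ W₂, ‖Qk F n K h c₀ cB U₀ v‖ ≤ CQ * ‖v‖)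
    {θS : ℝ} (hslot : ∀ X : PBond (F.P K) 0 → Matrix (Fin 2) (Fin 2) ℂ,
      RCLike.re ⟪toL2 F K c₀ X, (Δx U₀ - (DeltaEta F n K c₀ U₀ : BondL2K ℂ 3 (periodsT3 F K) c₀ W₂ →ₗ[ℂ] BondL2K ℂ 3 (periodsT3 F K) c₀ W₂)) (toL2 F K c₀ X)⟫_ℂ
          - θS * ‖toL2 F K c₀ X‖ ^ 2
        ≤ RCLike.re ⟪toL2 F K c₀ (fun b => w b.src • X b),
            (Δx U₀ - (DeltaEta F n K c₀ U₀ : BondL2K ℂ 3 (periodsT3 F K) c₀ W₂ →ₗ[ℂ] BondL2K ℂ 3 (periodsT3 F K) c₀ W₂)) (toL2 F K c₀ (fun b => (w b.src)⁻¹ • X b))⟫_ℂ) :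
    ∀ X : PBond (F.P K) 0 → Matrix (Fin 2) (Fin 2) ℂ,
      RCLike.re ⟪toL2 F K c₀ X, laplaceA F n K h c₀ cB a Δx U₀ (toL2 F K c₀ X)⟫_ℂ
          - (∑ μ : Fin (F.P K).d, ‖DL2 F n K c₀ U₀ (toL2S F K c₀ (formComp X μ))‖ ^ 2)
          - (a * (2 * Real.sqrt (216 * ρQ ^ 2 * (cB / (c₀ * ((F.L : ℝ) ^ (K - n)) ^ 3))) * CQ + 216 * ρQ ^ 2 * (cB / (c₀ * ((F.L : ℝ) ^ (K - n)) ^ 3)))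
              + Real.sqrt 2 * Ck * θc * (((F.P K).d : ℝ) * ((((F.P K).L : ℝ) ^ (F.P K).d) ^ (K - n)) * (2 * (1 + 1 / (μ' - ν))) ^ 3)
              + θS + 32 * Real.sqrt 2 * ε₀ * (((F.P K).d : ℝ) * (2 * 3) ^ (F.P K).d) * (1 + (1 + ρ) ^ 2)) * ‖toL2 F K c₀ X‖ ^ 2
        ≤ RCLike.re ⟪toL2 F K c₀ (fun b => w b.src • X b), laplaceA F n K h c₀ cB a Δx U₀ (toL2 F K c₀ (fun b => (w b.src)⁻¹ • X b))⟫_ℂ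
          - RCLike.re (∑ μ : Fin (F.P K).d, ⟪DL2 F n K c₀ U₀ (toL2S F K c₀ (formComp (fun b => w b.src • X b) μ)),
              DL2 F n K c₀ U₀ (toL2S F K c₀ (formComp (fun b => (w b.src)⁻¹ • X b) μ))⟫_ℂ) := by
  intro X
  -- the operator `B := D(1 − R_S)D*` and its displayed kernel row
  set B : BondL2K ℂ 3 (periodsT3 F K) c₀ W₂ →ₗ[ℂ] BondL2K ℂ 3 (periodsT3 F K) c₀ W₂ :=
    DL2 F n K c₀ U₀ ∘ₗ (LinearMap.id - RS F n K h c₀ cB U₀) ∘ₗ DstarL2 F n K c₀ U₀ with hB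
  have hBv : ∀ v, B v = DL2 F n K c₀ U₀ (DstarL2 F n K c₀ U₀ v - RS F n K h c₀ cB U₀ (DstarL2 F n K c₀ U₀ v)) := fun v => by
    simp only [hB, LinearMap.comp_apply, LinearMap.sub_apply, LinearMap.id_apply]
  have hkB : ∀ (b : PBond (F.P K) 0) (Z : Matrix (Fin 2) (Fin 2) ℂ) (bd : PBond (F.P K) 0),
      ‖(toL2 F K c₀).symm (B (toL2 F K c₀ (Pi.single b Z))) bd‖
        ≤ Ck * Real.exp (-(μ' * (Site.tdist (P := F.P K) (iterBlockOf (K - n) b.src) (iterBlockOf (K - n) bd.src) : ℝ))) * ‖Z‖ := fun b Z bd => by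
    rw [hBv]; exact hk b Z bd
  -- the four pieces
  have hP := abs_re_inner_conj_kernel_sub_le F B w hθc hCk hνμ hwfar hkB X
  rw [hBv, hBv] at hP
  have hQc := abs_re_inner_Qk_conj_sub_le F h c₀ cB hε₀ hε hε12 U₀ hreg w hw xr hρQ X
  have hS := hslot X
  have hL := hlocw_of_regPr F c₀ U₀ hε₀.le hreg w hw (fun b => ⟨hρ b, hρ' b⟩) X
  -- the two form identities (the projector vectors are frozen so that `re` distributes only over the five pieces)
  have hmix0 := inner_laplaceA_eq₂ (h := h) (cB := cB) (a := a) (Δx := Δx) U₀ (fun b => w b.src • X b) (fun b => (w b.src)⁻¹ • X b)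
  have hdiag0 := inner_laplaceA_eq₂ (h := h) (cB := cB) (a := a) (Δx := Δx) U₀ X X
  set vP' := DL2 F n K c₀ U₀ (DstarL2 F n K c₀ U₀ (toL2 F K c₀ (fun b => (w b.src)⁻¹ • X b))
    - RS F n K h c₀ cB U₀ (DstarL2 F n K c₀ U₀ (toL2 F K c₀ (fun b => (w b.src)⁻¹ • X b)))) with hvP'
  set vP := DL2 F n K c₀ U₀ (DstarL2 F n K c₀ U₀ (toL2 F K c₀ X) - RS F n K h c₀ cB U₀ (DstarL2 F n K c₀ U₀ (toL2 F K c₀ X))) with hvP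
  have hmix := congrArg RCLike.re hmix0
  have hdiag := congrArg RCLike.re hdiag0
  simp only [map_add, map_sub] at hmix hdiag
  -- real parts of the scalar pieces
  have hreQ' : RCLike.re (((a : ℝ) : ℂ) * ⟪Qk F n K h c₀ cB U₀ (toL2 F K c₀ (fun b => w b.src • X b)), Qk F n K h c₀ cB U₀ (toL2 F K c₀ (fun b => (w b.src)⁻¹ • X b))⟫_ℂ)
      = a * RCLike.re ⟪Qk F n K h c₀ cB U₀ (toL2 F K c₀ (fun b => w b.src • X b)), Qk F n K h c₀ cB U₀ (toL2 F K c₀ (fun b => (w b.src)⁻¹ • X b))⟫_ℂ := by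
    rw [RCLike.re_to_complex, Complex.re_ofReal_mul]; rfl
  have hreQ : RCLike.re (((a : ℝ) : ℂ) * ⟪Qk F n K h c₀ cB U₀ (toL2 F K c₀ X), Qk F n K h c₀ cB U₀ (toL2 F K c₀ X)⟫_ℂ) = a * ‖Qk F n K h c₀ cB U₀ (toL2 F K c₀ X)‖ ^ 2 := by
    rw [RCLike.re_to_complex, Complex.re_ofReal_mul, ← RCLike.re_to_complex, inner_self_eq_norm_sq (𝕜 := ℂ)]
  have hreK : RCLike.re (∑ μ : Fin (F.P K).d, ⟪DL2 F n K c₀ U₀ (toL2S F K c₀ (formComp X μ)), DL2 F n K c₀ U₀ (toL2S F K c₀ (formComp X μ))⟫_ℂ)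
      = ∑ μ : Fin (F.P K).d, ‖DL2 F n K c₀ U₀ (toL2S F K c₀ (formComp X μ))‖ ^ 2 := by
    rw [map_sum]; exact Finset.sum_congr rfl fun μ _ => inner_self_eq_norm_sq (𝕜 := ℂ) _
  rw [hreQ'] at hmix
  rw [hreQ, hreK] at hdiag
  -- the (Q) piece against the operator bound
  have hQX := hQ (toL2 F K c₀ X)
  have hκ0 : 0 ≤ Real.sqrt (216 * ρQ ^ 2 * (cB / (c₀ * ((F.L : ℝ) ^ (K - n)) ^ 3))) := Real.sqrt_nonneg _
  have hQ2 : 2 * Real.sqrt (216 * ρQ ^ 2 * (cB / (c₀ * ((F.L : ℝ) ^ (K - n)) ^ 3))) * ‖Qk F n K h c₀ cB U₀ (toL2 F K c₀ X)‖ * ‖toL2 F K c₀ X‖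
      ≤ 2 * Real.sqrt (216 * ρQ ^ 2 * (cB / (c₀ * ((F.L : ℝ) ^ (K - n)) ^ 3))) * CQ * ‖toL2 F K c₀ X‖ ^ 2 := by
    have := mul_le_mul_of_nonneg_right hQX (norm_nonneg (toL2 F K c₀ X))
    nlinarith [this, hκ0, norm_nonneg (toL2 F K c₀ X)]
  have hQabs := abs_le.mp hQc
  have hPabs := abs_le.mp hP
  have hX0 : 0 ≤ ‖toL2 F K c₀ X‖ ^ 2 := sq_nonneg _
  -- the (Q) piece times the coupling `a ≥ 0` (kept linear for `linarith`)
  have hQa : a * (‖Qk F n K h c₀ cB U₀ (toL2 F K c₀ X)‖ ^ 2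
        - (2 * Real.sqrt (216 * ρQ ^ 2 * (cB / (c₀ * ((F.L : ℝ) ^ (K - n)) ^ 3))) * CQ + 216 * ρQ ^ 2 * (cB / (c₀ * ((F.L : ℝ) ^ (K - n)) ^ 3))) * ‖toL2 F K c₀ X‖ ^ 2)
      ≤ a * RCLike.re ⟪Qk F n K h c₀ cB U₀ (toL2 F K c₀ (fun b => w b.src • X b)), Qk F n K h c₀ cB U₀ (toL2 F K c₀ (fun b => (w b.src)⁻¹ • X b))⟫_ℂ :=
    mul_le_mul_of_nonneg_left (by linarith [hQabs.1, hQ2]) ha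
  have e1 : a * (‖Qk F n K h c₀ cB U₀ (toL2 F K c₀ X)‖ ^ 2
        - (2 * Real.sqrt (216 * ρQ ^ 2 * (cB / (c₀ * ((F.L : ℝ) ^ (K - n)) ^ 3))) * CQ + 216 * ρQ ^ 2 * (cB / (c₀ * ((F.L : ℝ) ^ (K - n)) ^ 3))) * ‖toL2 F K c₀ X‖ ^ 2)
      = a * ‖Qk F n K h c₀ cB U₀ (toL2 F K c₀ X)‖ ^ 2
        - a * (2 * Real.sqrt (216 * ρQ ^ 2 * (cB / (c₀ * ((F.L : ℝ) ^ (K - n)) ^ 3))) * CQ + 216 * ρQ ^ 2 * (cB / (c₀ * ((F.L : ℝ) ^ (K - n)) ^ 3)))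
          * ‖toL2 F K c₀ X‖ ^ 2 := by ring
  rw [e1] at hQa
  linarith [hPabs.2, hS, hL, hQa, hmix, hdiag]

end Export


/-! ## §8 The slot of record: `Δx := DeltaEtaSlot`, no slot letter -/

section Slot

variable (F : T3Family) {n K : ℕ} (c₀ : ℝ) [Fact (0 < c₀)]

/-- At the slot of record `Δx := DeltaEtaSlot` (print's `G₀`, ✓`DeltaEtaSlot_apply`) the slot operator `Δx U₀ − Δ^η` vanishes, so the slot letter of §7 holds with `θ_S = 0`.
[cite: Balaban1985BackgroundPropagators, (3.26)–(3.27) p.395, p.421] -/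
theorem hslot_DeltaEtaSlot (U₀ : GaugeField (F.P K) 0 (Matrix.specialUnitaryGroup (Fin 2) ℂ)) (w : Site (F.P K) 0 → ℝ) :
    ∀ X : PBond (F.P K) 0 → Matrix (Fin 2) (Fin 2) ℂ,
      RCLike.re ⟪toL2 F K c₀ X, (DeltaEtaSlot F n K c₀ U₀ - (DeltaEta F n K c₀ U₀ : BondL2K ℂ 3 (periodsT3 F K) c₀ W₂ →ₗ[ℂ] BondL2K ℂ 3 (periodsT3 F K) c₀ W₂)) (toL2 F K c₀ X)⟫_ℂ
          - 0 * ‖toL2 F K c₀ X‖ ^ 2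
        ≤ RCLike.re ⟪toL2 F K c₀ (fun b => w b.src • X b),
            (DeltaEtaSlot F n K c₀ U₀ - (DeltaEta F n K c₀ U₀ : BondL2K ℂ 3 (periodsT3 F K) c₀ W₂ →ₗ[ℂ] BondL2K ℂ 3 (periodsT3 F K) c₀ W₂)) (toL2 F K c₀ (fun b => (w b.src)⁻¹ • X b))⟫_ℂ := by
  intro X
  have h0 : DeltaEtaSlot F n K c₀ U₀ - (DeltaEta F n K c₀ U₀ : BondL2K ℂ 3 (periodsT3 F K) c₀ W₂ →ₗ[ℂ] BondL2K ℂ 3 (periodsT3 F K) c₀ W₂) = 0 := by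
    rw [sub_eq_zero]; rfl
  simp only [h0, LinearMap.zero_apply, inner_zero_right, map_zero, zero_mul, sub_zero, le_refl]

end Slot

end Summit.QuantumFields.YangMills.Theorems.Prop7OneFormAgmonConj

end
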